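import Literature.Probability.RandomPlanarGeometry.SAWPatternFiniteMemoryCheck
import Literature.Probability.RandomPlanarGeometry.SAWHairpinDensity
import Literature.Probability.RandomPlanarGeometry.SAWBendingEnergy
import Mathlib.Analysis.SpecialFunctions.Pow.Real
import HarnessLib

/-!
# Typical-frequency windows for turns and tight U-turns of planar self-avoiding walks: the shapes,
# the word dictionary, the certified pressures and the Chernoff transfer

Topic `Literature/Probability/RandomPlanarGeometry` (continues `SAWPatternFiniteMemoryCheck.lean`).
Kesten's pattern theorem (Madras–Slade 1993, Theorem 7.2.3) says that a proper pattern occurs at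
least `aN` times on all but exponentially few `N`-step self-avoiding walks, with an INEXPLICIT
`a > 0`; no explicit UPPER frequency bound is printed. This file sets up explicit two-sided
windows for the two simplest local statistics on `ℤ²` — the number of TURNS (consecutive steps
differ) and of TIGHT U-TURNS (the pattern `(e, f, -e)`, the tree's `Zd.hairpinAt`):

* the event family `Zd.turnAt`, the count `Zd.turns` and the bending partition function `Zd.Zbend`
  are the tree's (`SAWBendingEnergy.lean`, same bodies as the lane planner's sketch); here: the
  U-turn count `Zd.uturns` (in the format of `Zd.occ`) and the
  window shapes `Zd.TurnsLower a θ C` (`#{ω ∈ S_N : turns ≤ a(N-1)} ≤ C θ^N μ^N` for all `N`),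
  `Zd.TurnsUpper`, `Zd.UTurnsLower`, `Zd.UTurnsUpper`, `Zd.TurnWindow a b` (both edges with one
  `θ < 1`), `Zd.UTurnWindow`; the bending partition function `Zd.Zbend N t = Σ_{S_N} t^{turns}` and
  `Zd.ZUbend`, with the all-`N` bound shapes `Zd.ZbendUpper t Λ C`, `Zd.ZUbendUpper`;
* the DICTIONARY with the step-word model: `turns N (traj w) = patCount 0 w`,
  `uturns N (traj w) = patCount 1 w` (`FiniteMemory.turns_traj`, `uturns_traj`), hence
  `card_saws_filter_turns_eq`, `sum_saws_turns_eq` (and the U-turn twins);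
* the CERTIFIED PRESSURES: `FiniteMemory.zbendUpper_of_checkPC` — a successful pattern-weighted
  finite-memory check `checkPC K 0 p q N D ·` gives `Z_n(p/q) ≤ 2⁴¹ (N/(Dq))ⁿ` for every `n`
  (`zubendUpper_of_checkPC` for U-turns);
* the CHERNOFF TRANSFER (exponential Chebyshev inequality): `Zd.chernoffUpper` — from
  `Z_N(t) ≤ C Λ^N` at `t > 1` and any certified `0 < μlo ≤ μ(ℤ²)`,
  `#{turns ≥ b(N-1)} ≤ (C t^b) (Λ/(t^b μlo))^N μ^N`, i.e. `TurnsUpper b (Λ/(t^b μlo)) (C t^b)`;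
  `Zd.chernoffLower` (`t < 1`, constant `C t^a`; `chernoffLower'` has the weaker `C t^{-a}`),
  `chernoffUpperU`, `chernoffLowerU` (thresholds `bN`, `aN`); monotonicity of the shapes and
  `turnWindow_of_edges`; the numeric edge test `theta_lt_one`
  (`Λ^n < t^m μlo^n ⇒ Λ/(t^{m/n} μlo) < 1`).

The explicit windows for `ℤ²` (memory-18 certificates) are in `SAWTurnDensityWindowZ2.lean`.

## References

* N. Madras, G. Slade, *The Self-Avoiding Walk* (1993), §7.1 (patterns), Theorem 7.2.3 (Kesten's
  pattern theorem), §1.2 [MadrasSlade1993].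
* A. Pönitz, P. Tittmann, *Improved upper bounds for self-avoiding walks in ℤᵈ*, Electron. J.
  Combin. 7 (2000) R21, §3 [PonitzTittmann2000].
* H. Kesten, *On the number of self-avoiding walks*, J. Math. Phys. 4 (1963) 960–969 (the pattern
  theorem) [Kesten1963].
-/

noncomputable section

open Finset Literature.Probability.LatticeModels
open scoped BigOperators

namespace Literature.Probability.RandomPlanarGeometry.SAW

/-! ### Turns and tight U-turns of a walk (event families in the format of `Zd.occ`) -/

namespace Zd

-- `Zd.turnAt`, `Zd.turns` (turn event family and count) are declared in `SAWBendingEnergy.lean`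
-- with the same bodies (`turnAt N ω j := j + 2 ≤ N ∧ ω (j+2) - ω (j+1) ≠ ω (j+1) - ω j`,
-- `turns N ω := Zd.occ turnAt N ω`); this file adds the U-turn count.

/-- The number of tight U-turns (`Zd.hairpinAt`) of the `N`-step walk `ω` on `ℤ²` (a-idea-2's
`uturns`, verbatim). [cite: MadrasSlade1993, §7.1] -/
noncomputable def uturns (N : ℕ) (ω : ℕ → Site 2) : ℕ := Zd.occ (d := 0) Zd.hairpinAt N ω

end Zd

/-! ### Dictionary: the event counts of a walk are the pattern counts of its step word -/

namespace FiniteMemory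

/-- The last two letters of the prefix of length `i + 1`. [folklore] -/
private theorem lastTwo_take_succ (w : List Step) {i : ℕ} (hi : i < w.length) :
    lastTwo (w.take (i + 1)) = w[i] :: (lastTwo (w.take i)).take 1 := by
  rw [List.take_succ_eq_append_getElem hi, lastTwo_append_singleton]

/-- The last two letters of the prefix of length `i + 2`. [folklore] -/
private theorem lastTwo_take_succ_succ (w : List Step) {i : ℕ} (hi : i + 1 < w.length) :
    lastTwo (w.take (i + 2)) = [w[i + 1], w[i]] := by
  rw [lastTwo_take_succ w hi, lastTwo_take_succ w (by omega : i < w.length), List.take_succ_cons,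
    List.take_zero]

/-- Reversal on the step alphabet is negation of the step vector: `vec (d + 2) = -vec d`. [folklore] -/
private theorem vec_add_two (d : Step) : Step.vec (d + 2) = -Step.vec d := by
  ext i
  fin_cases d <;> fin_cases i <;> simp [Step.vec, Step.dx, Step.dy]

/-- The step of the trajectory: `traj w (j+1) - traj w j = vec w_j`. [folklore] -/
private theorem traj_succ_sub (w : List Step) {j : ℕ} (hj : j < w.length) :
    traj w (j + 1) - traj w j = Step.vec (w[j]) := by
  rw [traj_succ w hj, add_sub_cancel_left]

/-- **Turns of a self-avoiding walk = turn count of its word.** [cite: MadrasSlade1993, §7.1] -/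
theorem turns_traj (w : List Step) : Zd.turns w.length (traj w) = patCount 0 w := by
  classical
  rw [Zd.turns, Zd.occ, patCount]
  -- the word-side set is the successor image of the walk-side set
  have key : ((range w.length).filter fun i => patSel 0 (lastTwo (w.take i)) (w.getD i 0) = true) =
      ((range (w.length + 1)).filter (Zd.turnAt w.length (traj w))).map
        ⟨Nat.succ, Nat.succ_injective⟩ := by
    ext i
    simp only [mem_filter, mem_range, mem_map, Function.Embedding.coeFn_mk, Zd.turnAt, patSel,
      if_true]
    constructor
    · rintro ⟨hi, hsel⟩
      cases i with
      | zero => simp [lastTwo, turnSel] at hsel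
      | succ j =>
        refine ⟨j, ⟨by omega, by omega, ?_⟩, rfl⟩
        rw [lastTwo_take_succ w (by omega : j < w.length)] at hsel
        simp only [turnSel, decide_eq_true_eq, List.getD_eq_getElem?_getD,
          List.getElem?_eq_getElem hi, Option.getD_some] at hsel
        rw [show j + 2 = (j + 1) + 1 by ring, traj_succ_sub w hi, traj_succ_sub w (by omega)]
        exact fun h => hsel (Step.vec_injective h).symm
    · rintro ⟨j, ⟨-, hj2, hne⟩, rfl⟩
      have hj1 : j + 1 < w.length := by omega
      refine ⟨hj1, ?_⟩
      rw [lastTwo_take_succ w (by omega : j < w.length)]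
      simp only [turnSel, decide_eq_true_eq, List.getD_eq_getElem?_getD, List.getElem?_eq_getElem hj1,
        Option.getD_some]
      rw [show j + 2 = (j + 1) + 1 by ring, traj_succ_sub w hj1, traj_succ_sub w (by omega)] at hne
      exact fun h => hne (by rw [h])
  rw [key, card_map]

/-- **Tight U-turns of a self-avoiding walk = U-turn count of its word.** [cite: MadrasSlade1993, §7.1] -/
theorem uturns_traj (w : List Step) : Zd.uturns w.length (traj w) = patCount 1 w := by
  classical
  rw [Zd.uturns, Zd.occ, patCount]
  have key : ((range w.length).filter fun i => patSel 1 (lastTwo (w.take i)) (w.getD i 0) = true) =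
      ((range (w.length + 1)).filter (Zd.hairpinAt w.length (traj w))).map
        ⟨fun j => j + 2, fun a b h => by simpa using h⟩ := by
    ext i
    simp only [mem_filter, mem_range, mem_map, Function.Embedding.coeFn_mk, Zd.hairpinAt, patSel,
      one_ne_zero, if_false]
    constructor
    · rintro ⟨hi, hsel⟩
      match i, hi, hsel with
      | 0, _, hsel => simp [lastTwo, uturnSel] at hsel
      | 1, hi, hsel =>
        rw [lastTwo_take_succ w (by omega : 0 < w.length)] at hsel
        simp [uturnSel, lastTwo] at hsel
      | j + 2, hi, hsel =>
        refine ⟨j, ⟨by omega, by omega, ?_⟩, rfl⟩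
        rw [lastTwo_take_succ_succ w (by omega : j + 1 < w.length)] at hsel
        simp only [uturnSel, decide_eq_true_eq, List.getD_eq_getElem?_getD,
          List.getElem?_eq_getElem hi, Option.getD_some] at hsel
        rw [show j + 3 = (j + 2) + 1 by ring, traj_succ_sub w hi, ← neg_sub (traj w (j + 1)) (traj w j),
          traj_succ_sub w (by omega), hsel, vec_add_two]
    · rintro ⟨j, ⟨-, hj3, heq⟩, rfl⟩
      have hj2 : j + 2 < w.length := by omega
      refine ⟨hj2, ?_⟩
      rw [lastTwo_take_succ_succ w (by omega : j + 1 < w.length)]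
      simp only [uturnSel, decide_eq_true_eq, List.getD_eq_getElem?_getD, List.getElem?_eq_getElem hj2,
        Option.getD_some]
      rw [show j + 3 = (j + 2) + 1 by ring, traj_succ_sub w hj2, ← neg_sub (traj w (j + 1)) (traj w j),
        traj_succ_sub w (by omega), ← vec_add_two] at heq
      exact Step.vec_injective heq
  rw [key, card_map]

/-- **Word/walk dictionary for turn events**: for every predicate `P` on the count,
`#{ω ∈ SAW_N : P (turns ω)} = #{w ∈ sawWords N : P (patCount 0 w)}`. [cite: MadrasSlade1993, §1.1] -/
theorem card_saws_filter_turns_eq (N : ℕ) (P : ℕ → Prop) [DecidablePred P] :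
    ((Zd.saws 2 N).filter fun ω => P (Zd.turns N ω)).card =
      ((sawWords N).filter fun w => P (patCount 0 w)).card := by
  classical
  rw [← image_traj_sawWords, filter_image, card_image_of_injOn]
  · congr 1
    ext w
    simp only [mem_filter, mem_sawWords, and_congr_right_iff]
    rintro ⟨hl, -⟩
    rw [← hl, turns_traj]
  · intro w hw w' hw' h
    simp only [coe_filter, Set.mem_setOf_eq, mem_sawWords] at hw hw'
    exact eq_of_traj_eq (by rw [hw.1.1, hw'.1.1]) h

/-- **Word/walk dictionary for tight-U-turn events.** [cite: MadrasSlade1993, §1.1] -/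
theorem card_saws_filter_uturns_eq (N : ℕ) (P : ℕ → Prop) [DecidablePred P] :
    ((Zd.saws 2 N).filter fun ω => P (Zd.uturns N ω)).card =
      ((sawWords N).filter fun w => P (patCount 1 w)).card := by
  classical
  rw [← image_traj_sawWords, filter_image, card_image_of_injOn]
  · congr 1
    ext w
    simp only [mem_filter, mem_sawWords, and_congr_right_iff]
    rintro ⟨hl, -⟩
    rw [← hl, uturns_traj]
  · intro w hw w' hw' h
    simp only [coe_filter, Set.mem_setOf_eq, mem_sawWords] at hw hw'
    exact eq_of_traj_eq (by rw [hw.1.1, hw'.1.1]) h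

/-- **Sums over walks = sums over words** for a function of the turn count. [cite: MadrasSlade1993, §1.1] -/
theorem sum_saws_turns_eq (N : ℕ) (f : ℕ → ℝ) :
    ∑ ω ∈ Zd.saws 2 N, f (Zd.turns N ω) = ∑ w ∈ sawWords N, f (patCount 0 w) := by
  classical
  rw [← image_traj_sawWords, sum_image]
  · refine sum_congr rfl fun w hw => ?_
    rw [mem_sawWords] at hw
    rw [← hw.1, turns_traj]
  · intro w hw w' hw' h
    simp only [mem_coe, mem_sawWords] at hw hw'
    exact eq_of_traj_eq (by rw [hw.1, hw'.1]) h

/-- **Sums over walks = sums over words** for a function of the U-turn count. [cite: MadrasSlade1993, §1.1] -/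
theorem sum_saws_uturns_eq (N : ℕ) (f : ℕ → ℝ) :
    ∑ ω ∈ Zd.saws 2 N, f (Zd.uturns N ω) = ∑ w ∈ sawWords N, f (patCount 1 w) := by
  classical
  rw [← image_traj_sawWords, sum_image]
  · refine sum_congr rfl fun w hw => ?_
    rw [mem_sawWords] at hw
    rw [← hw.1, uturns_traj]
  · intro w hw w' hw' h
    simp only [mem_coe, mem_sawWords] at hw hw'
    exact eq_of_traj_eq (by rw [hw.1, hw'.1]) h

end FiniteMemory

end Literature.Probability.RandomPlanarGeometry.SAW
namespace Literature.Probability.RandomPlanarGeometry.SAW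

/-! ### The window shapes (lane «PRESS», a-idea-2's `Sketch_v7`, verbatim bodies) -/

namespace Zd

/-- LOWER window edge for turns: the walks with at most `a·(N-1)` turns number at most
`C θ^N μ^N`. [cite: MadrasSlade1993, Theorem 7.2.3 (shape of Kesten's pattern theorem)] -/
def TurnsLower (a θ C : ℝ) : Prop :=
  ∀ N : ℕ, (((Zd.saws 2 N).filter fun ω => (turns N ω : ℝ) ≤ a * ((N : ℝ) - 1)).card : ℝ)
    ≤ C * θ ^ N * connectiveConstant 2 ^ N

/-- UPPER window edge for turns: the walks with at least `b·(N-1)` turns number at most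
`C θ^N μ^N`. [cite: MadrasSlade1993, Theorem 7.2.3 (shape of Kesten's pattern theorem)] -/
def TurnsUpper (b θ C : ℝ) : Prop :=
  ∀ N : ℕ, (((Zd.saws 2 N).filter fun ω => b * ((N : ℝ) - 1) ≤ (turns N ω : ℝ)).card : ℝ)
    ≤ C * θ ^ N * connectiveConstant 2 ^ N

/-- LOWER window edge for tight U-turns (threshold `a·N`, the tree's convention in
`Zd.hairpin_density_explicit`). [cite: MadrasSlade1993, Theorem 7.2.3] -/
def UTurnsLower (a θ C : ℝ) : Prop :=
  ∀ N : ℕ, (((Zd.saws 2 N).filter fun ω => (uturns N ω : ℝ) ≤ a * (N : ℝ)).card : ℝ)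
    ≤ C * θ ^ N * connectiveConstant 2 ^ N

/-- UPPER window edge for tight U-turns (threshold `b·N`; the trivial sup-density is `1/2`).
[cite: MadrasSlade1993, Theorem 7.2.3 (shape)] -/
def UTurnsUpper (b θ C : ℝ) : Prop :=
  ∀ N : ℕ, (((Zd.saws 2 N).filter fun ω => b * (N : ℝ) ≤ (uturns N ω : ℝ)).card : ℝ)
    ≤ C * θ ^ N * connectiveConstant 2 ^ N

/-- The two-sided WINDOW for turns: all but exponentially few `N`-step self-avoiding walks have
turn frequency in `[a, b]`. [cite: MadrasSlade1993, Theorem 7.2.3 (shape)] -/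
def TurnWindow (a b : ℝ) : Prop :=
  ∃ θ C : ℝ, θ < 1 ∧ TurnsLower a θ C ∧ TurnsUpper b θ C

/-- The two-sided WINDOW for tight U-turns. [cite: MadrasSlade1993, Theorem 7.2.3 (shape)] -/
def UTurnWindow (a b : ℝ) : Prop :=
  ∃ θ C : ℝ, θ < 1 ∧ UTurnsLower a θ C ∧ UTurnsUpper b θ C

-- `Zd.Zbend N t = Σ_{ω ∈ S_N} t^{turns N ω}` is declared in `SAWBendingEnergy.lean` (same body).

/-- The U-turn-weighted partition function `Σ_{ω ∈ S_N} t^{uturns ω}`. [cite: MadrasSlade1993, §7.1] -/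
noncomputable def ZUbend (N : ℕ) (t : ℝ) : ℝ := ∑ ω ∈ Zd.saws 2 N, t ^ uturns N ω

/-- An all-`N` exponential upper bound on the bending partition function, `Z_N(t) ≤ C Λ^N`.
[cite: MadrasSlade1993, §7.1] -/
def ZbendUpper (t Λ C : ℝ) : Prop := ∀ N : ℕ, Zbend N t ≤ C * Λ ^ N

/-- An all-`N` exponential upper bound on the U-turn-weighted partition function.
[cite: MadrasSlade1993, §7.1] -/
def ZUbendUpper (t Λ C : ℝ) : Prop := ∀ N : ℕ, ZUbend N t ≤ C * Λ ^ N

end Zd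

/-! ### The certified pressures: `Z_N(t) ≤ 2⁴¹ Λⁿ` from a successful pattern-weighted check -/

namespace FiniteMemory

/-- The tilted sum over words at tilt `p/q`, from the `ℕ`-certificate. [cite: PonitzTittmann2000, §3] -/
theorem sum_sawWords_div_pow_le_of_checkPC {K sel p q Nn Dd iters : ℕ}
    (h : checkPC K sel p q Nn Dd iters = true) (hq : 0 < q) (hD : 0 < Dd) (n : ℕ) :
    ∑ w ∈ sawWords n, ((p : ℝ) / q) ^ patCount sel w ≤ 2 ^ 41 * ((Nn : ℝ) / (Dd * q)) ^ n := by
  have hq' : (0 : ℝ) < q := by exact_mod_cast hq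
  have hD' : (0 : ℝ) < Dd := by exact_mod_cast hD
  have hqn : (0 : ℝ) < (q : ℝ) ^ n := pow_pos hq' n
  have hDn : (0 : ℝ) < (Dd : ℝ) ^ n := pow_pos hD' n
  have h1 : (∑ w ∈ sawWords n, (p : ℝ) ^ patCount sel w * (q : ℝ) ^ (n - patCount sel w)) * (Dd : ℝ) ^ n ≤
      (Nn : ℝ) ^ n * 2 ^ 41 := by
    exact_mod_cast sum_sawWords_patW_mul_pow_le_of_checkPC h n
  have h2 : ∑ w ∈ sawWords n, ((p : ℝ) / q) ^ patCount sel w =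
      (∑ w ∈ sawWords n, (p : ℝ) ^ patCount sel w * (q : ℝ) ^ (n - patCount sel w)) / (q : ℝ) ^ n := by
    rw [sum_div]
    refine sum_congr rfl fun w hw => ?_
    have hc : patCount sel w ≤ n := by
      rw [mem_sawWords] at hw; rw [← hw.1]; exact patCount_le_length sel w
    rw [div_pow, div_eq_div_iff (pow_ne_zero _ hq'.ne') hqn.ne', mul_assoc, ← pow_add,
      Nat.sub_add_cancel hc]
  rw [h2, div_le_iff₀ hqn]
  have h3 : 2 ^ 41 * ((Nn : ℝ) / (Dd * q)) ^ n * (q : ℝ) ^ n = (Nn : ℝ) ^ n * 2 ^ 41 / (Dd : ℝ) ^ n := by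
    rw [div_pow, mul_pow]; field_simp
  rw [h3, le_div_iff₀ hDn]
  exact h1

/-- **Certified bending pressure**: `checkPC K 0 p q N D · = true ⇒ Z_n(p/q) ≤ 2⁴¹ (N/(Dq))ⁿ` for
every `n`. [cite: PonitzTittmann2000, §3] -/
theorem zbendUpper_of_checkPC {K p q Nn Dd iters : ℕ} (h : checkPC K 0 p q Nn Dd iters = true)
    (hq : 0 < q) (hD : 0 < Dd) : Zd.ZbendUpper ((p : ℝ) / q) ((Nn : ℝ) / (Dd * q)) (2 ^ 41) := by
  intro n
  rw [Zd.Zbend, sum_saws_turns_eq n (fun c => ((p : ℝ) / q) ^ c)]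
  exact sum_sawWords_div_pow_le_of_checkPC h hq hD n

/-- **Certified U-turn pressure**: `checkPC K 1 p q N D · = true ⇒ Σ_{S_n} (p/q)^{uturns} ≤ 2⁴¹ (N/(Dq))ⁿ`.
[cite: PonitzTittmann2000, §3] -/
theorem zubendUpper_of_checkPC {K p q Nn Dd iters : ℕ} (h : checkPC K 1 p q Nn Dd iters = true)
    (hq : 0 < q) (hD : 0 < Dd) : Zd.ZUbendUpper ((p : ℝ) / q) ((Nn : ℝ) / (Dd * q)) (2 ^ 41) := by
  intro n
  rw [Zd.ZUbend, sum_saws_uturns_eq n (fun c => ((p : ℝ) / q) ^ c)]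
  exact sum_sawWords_div_pow_le_of_checkPC h hq hD n

end FiniteMemory

/-! ### The exponential Chebyshev (Chernoff) transfer -/

namespace Zd

/-- Markov's inequality on a finite set: if `f ≥ 0` on `S`, `f ≥ m > 0` on `F ⊆ S` and
`Σ_S f ≤ B`, then `#F ≤ B/m`. [cite: MadrasSlade1993, §1.2] -/
private theorem card_le_div_of_le_sum {α : Type*} {S F : Finset α} (hF : F ⊆ S) {f : α → ℝ}
    (hf : ∀ x ∈ S, 0 ≤ f x) {m B : ℝ} (hm : 0 < m) (hlow : ∀ x ∈ F, m ≤ f x)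
    (hsum : ∑ x ∈ S, f x ≤ B) : (F.card : ℝ) ≤ B / m := by
  rw [le_div_iff₀ hm]
  calc (F.card : ℝ) * m = ∑ _x ∈ F, m := by rw [sum_const, nsmul_eq_mul]
    _ ≤ ∑ x ∈ F, f x := sum_le_sum hlow
    _ ≤ ∑ x ∈ S, f x := sum_le_sum_of_subset_of_nonneg hF fun x hx _ => hf x hx
    _ ≤ B := hsum


/-- `S_N ≠ ∅` (`c_N ≥ μ^N > 0`). [cite: MadrasSlade1993, §1.2] -/
private theorem card_saws_pos (N : ℕ) : 0 < (Zd.saws 2 N).card := by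
  have h : (0 : ℝ) < (Zd.count 2 N : ℝ) :=
    lt_of_lt_of_le (pow_pos (Zd.connectiveConstant_pos 2) N) (Zd.pow_connectiveConstant_le_count 2 N)
  rw [Zd.card_saws]; exact_mod_cast h

/-- A growth rate bounding a positive partition function is nonnegative. [cite: MadrasSlade1993, §1.2] -/
private theorem rate_nonneg_of_zbendUpper {t Λ C : ℝ} (ht0 : 0 < t) (hC : 0 ≤ C)
    (hZ : ZbendUpper t Λ C) : 0 ≤ Λ := by
  by_contra hneg
  rw [not_le] at hneg
  have h1 := hZ 1
  have hpos : 0 < Zbend 1 t :=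
    sum_pos (fun ω _ => pow_pos ht0 _) (Finset.card_pos.1 (card_saws_pos 1))
  have : C * Λ ^ 1 ≤ 0 := by rw [pow_one]; exact mul_nonpos_of_nonneg_of_nonpos hC hneg.le
  linarith

/-- The same for the U-turn-weighted partition function. [cite: MadrasSlade1993, §1.2] -/
private theorem rate_nonneg_of_zubendUpper {t Λ C : ℝ} (ht0 : 0 < t) (hC : 0 ≤ C)
    (hZ : ZUbendUpper t Λ C) : 0 ≤ Λ := by
  by_contra hneg
  rw [not_le] at hneg
  have h1 := hZ 1
  have hpos : 0 < ZUbend 1 t :=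
    sum_pos (fun ω _ => pow_pos ht0 _) (Finset.card_pos.1 (card_saws_pos 1))
  have : C * Λ ^ 1 ≤ 0 := by rw [pow_one]; exact mul_nonpos_of_nonneg_of_nonpos hC hneg.le
  linarith

/-- The algebra of the transfer: `C Λ^N / t^{x(N-1)} = (C t^x) (Λ/(t^x μlo))^N μlo^N`.
[cite: MadrasSlade1993, §1.2] -/
private theorem transfer_identity {t Λ C x μlo : ℝ} (ht : 0 < t) (hμ : 0 < μlo) (N : ℕ) :
    C * Λ ^ N / t ^ (x * ((N : ℝ) - 1)) = C * t ^ x * (Λ / (t ^ x * μlo)) ^ N * μlo ^ N := by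
  have htx : 0 < t ^ x := Real.rpow_pos_of_pos ht x
  have h1 : t ^ (x * ((N : ℝ) - 1)) = (t ^ x) ^ N / t ^ x := by
    rw [show x * ((N : ℝ) - 1) = x * N - x by ring, Real.rpow_sub ht, Real.rpow_mul ht.le,
      Real.rpow_natCast]
  rw [h1, div_pow, mul_pow]
  field_simp

/-- The algebra of the transfer at threshold `x·N`: `C Λ^N / t^{xN} = C (Λ/(t^x μlo))^N μlo^N`.
[cite: MadrasSlade1993, §1.2] -/
private theorem transfer_identity' {t Λ C x μlo : ℝ} (ht : 0 < t) (hμ : 0 < μlo) (N : ℕ) :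
    C * Λ ^ N / t ^ (x * (N : ℝ)) = C * (Λ / (t ^ x * μlo)) ^ N * μlo ^ N := by
  have htx : 0 < t ^ x := Real.rpow_pos_of_pos ht x
  rw [Real.rpow_mul ht.le, Real.rpow_natCast, div_pow, mul_pow]
  field_simp

/-- The last step: `(C')(θ)^N μlo^N ≤ C' θ^N μ^N` for `0 < μlo ≤ μ`, `0 ≤ C'`, `0 ≤ θ`.
[cite: MadrasSlade1993, §1.2] -/
private theorem mono_mu {C' θ μlo : ℝ} (hC : 0 ≤ C') (hθ : 0 ≤ θ) (hμ0 : 0 < μlo)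
    (hμ : μlo ≤ connectiveConstant 2) (N : ℕ) :
    C' * θ ^ N * μlo ^ N ≤ C' * θ ^ N * connectiveConstant 2 ^ N :=
  mul_le_mul_of_nonneg_left (pow_le_pow_left₀ hμ0.le hμ N) (mul_nonneg hC (pow_nonneg hθ N))

/-- **Chernoff transfer, upper edge for turns** (a-idea-2's `ChernoffUpper`, verbatim conclusion):
an exponential bound `Z_N(t) ≤ C Λ^N` at some `t > 1` and a lower bound `0 < μlo ≤ μ` give
`TurnsUpper b (Λ/(t^b μlo)) (C t^b)` for every real `b` (a-idea-2 asks `b ≥ 0`; not needed).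
[cite: MadrasSlade1993, Theorem 7.2.3 (shape); PonitzTittmann2000, §3] -/
theorem chernoffUpper (t Λ C b μlo : ℝ) (ht : 1 < t) (hC : 0 ≤ C) (hμ0 : 0 < μlo)
    (hμ : μlo ≤ connectiveConstant 2) (hZ : ZbendUpper t Λ C) :
    TurnsUpper b (Λ / (t ^ b * μlo)) (C * t ^ b) := by
  intro N
  have ht0 : 0 < t := lt_trans one_pos ht
  have htb : 0 < t ^ b := Real.rpow_pos_of_pos ht0 b
  have hm : 0 < t ^ (b * ((N : ℝ) - 1)) := Real.rpow_pos_of_pos ht0 _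
  have hΛ : 0 ≤ Λ := rate_nonneg_of_zbendUpper ht0 hC hZ
  have key := card_le_div_of_le_sum
    (filter_subset (fun ω => b * ((N : ℝ) - 1) ≤ (turns N ω : ℝ)) (Zd.saws 2 N))
    (f := fun ω => t ^ turns N ω) (fun ω _ => pow_nonneg ht0.le _) hm
    (fun ω hω => by
      rw [mem_filter] at hω
      rw [← Real.rpow_natCast]
      exact Real.rpow_le_rpow_of_exponent_le ht.le hω.2) (hZ N)
  refine key.trans ?_
  rw [transfer_identity ht0 hμ0]
  exact mono_mu (mul_nonneg hC htb.le) (div_nonneg hΛ (mul_pos htb hμ0).le) hμ0 hμ N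

/-- **Chernoff transfer, lower edge for turns**: `Z_N(t) ≤ C Λ^N` at some `0 < t < 1` and
`0 < μlo ≤ μ` give `TurnsLower a (Λ/(t^a μlo)) (C t^a)` for every real `a` (sharper constant than
a-idea-2's `ChernoffLower`, which has `C t^{-a}`; see `chernoffLower'`).
[cite: MadrasSlade1993, Theorem 7.2.3 (shape); PonitzTittmann2000, §3] -/
theorem chernoffLower (t Λ C a μlo : ℝ) (ht0 : 0 < t) (ht1 : t < 1) (hC : 0 ≤ C) (hμ0 : 0 < μlo)
    (hμ : μlo ≤ connectiveConstant 2) (hZ : ZbendUpper t Λ C) :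
    TurnsLower a (Λ / (t ^ a * μlo)) (C * t ^ a) := by
  intro N
  have hta : 0 < t ^ a := Real.rpow_pos_of_pos ht0 a
  have hm : 0 < t ^ (a * ((N : ℝ) - 1)) := Real.rpow_pos_of_pos ht0 _
  have hΛ : 0 ≤ Λ := rate_nonneg_of_zbendUpper ht0 hC hZ
  have key := card_le_div_of_le_sum
    (filter_subset (fun ω => (turns N ω : ℝ) ≤ a * ((N : ℝ) - 1)) (Zd.saws 2 N))
    (f := fun ω => t ^ turns N ω) (fun ω _ => pow_nonneg ht0.le _) hm
    (fun ω hω => by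
      rw [mem_filter] at hω
      rw [← Real.rpow_natCast]
      exact Real.rpow_le_rpow_of_exponent_ge ht0 ht1.le hω.2) (hZ N)
  refine key.trans ?_
  rw [transfer_identity ht0 hμ0]
  exact mono_mu (mul_nonneg hC hta.le) (div_nonneg hΛ (mul_pos hta hμ0).le) hμ0 hμ N

/-- a-idea-2's `ChernoffLower`, verbatim conclusion `TurnsLower a (Λ · t^{-a}/μlo) (C · t^{-a})`
(weaker constant, since `t^a ≤ 1 ≤ t^{-a}`). [cite: MadrasSlade1993, Theorem 7.2.3 (shape)] -/
theorem chernoffLower' (t Λ C a μlo : ℝ) (ht0 : 0 < t) (ht1 : t < 1) (hC : 0 ≤ C) (hμ0 : 0 < μlo)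
    (hμ : μlo ≤ connectiveConstant 2) (ha : 0 ≤ a) (hZ : ZbendUpper t Λ C) :
    TurnsLower a (Λ * t ^ (-a) / μlo) (C * t ^ (-a)) := by
  intro N
  have h := chernoffLower t Λ C a μlo ht0 ht1 hC hμ0 hμ hZ N
  have hta : 0 < t ^ a := Real.rpow_pos_of_pos ht0 a
  have hθ : Λ / (t ^ a * μlo) = Λ * t ^ (-a) / μlo := by
    rw [Real.rpow_neg ht0.le]; field_simp
  have hθ0 : 0 ≤ Λ / (t ^ a * μlo) :=
    div_nonneg (rate_nonneg_of_zbendUpper ht0 hC hZ) (mul_pos hta hμ0).le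
  rw [← hθ]
  refine h.trans (mul_le_mul_of_nonneg_right (mul_le_mul_of_nonneg_right
    (mul_le_mul_of_nonneg_left ?_ hC) (pow_nonneg hθ0 N)) (pow_nonneg (connectiveConstant_pos 2).le N))
  calc t ^ a ≤ 1 := Real.rpow_le_one ht0.le ht1.le ha
    _ ≤ t ^ (-a) := Real.one_le_rpow_of_pos_of_le_one_of_nonpos ht0 ht1.le (by linarith)

/-- **Chernoff transfer, upper edge for tight U-turns** (threshold `b·N`): `Σ_{S_N} t^{uturns} ≤ C Λ^N`
at `1 < t` and `0 < μlo ≤ μ` give `UTurnsUpper b (Λ/(t^b μlo)) C`.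
[cite: MadrasSlade1993, Theorem 7.2.3 (shape); PonitzTittmann2000, §3] -/
theorem chernoffUpperU (t Λ C b μlo : ℝ) (ht : 1 < t) (hC : 0 ≤ C) (hμ0 : 0 < μlo)
    (hμ : μlo ≤ connectiveConstant 2) (hZ : ZUbendUpper t Λ C) :
    UTurnsUpper b (Λ / (t ^ b * μlo)) C := by
  intro N
  have ht0 : 0 < t := lt_trans one_pos ht
  have htb : 0 < t ^ b := Real.rpow_pos_of_pos ht0 b
  have hm : 0 < t ^ (b * (N : ℝ)) := Real.rpow_pos_of_pos ht0 _
  have hΛ : 0 ≤ Λ := rate_nonneg_of_zubendUpper ht0 hC hZ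
  have key := card_le_div_of_le_sum
    (filter_subset (fun ω => b * (N : ℝ) ≤ (uturns N ω : ℝ)) (Zd.saws 2 N))
    (f := fun ω => t ^ uturns N ω) (fun ω _ => pow_nonneg ht0.le _) hm
    (fun ω hω => by
      rw [mem_filter] at hω
      rw [← Real.rpow_natCast]
      exact Real.rpow_le_rpow_of_exponent_le ht.le hω.2) (hZ N)
  refine key.trans ?_
  rw [transfer_identity' ht0 hμ0]
  exact mono_mu hC (div_nonneg hΛ (mul_pos htb hμ0).le) hμ0 hμ N

/-- **Chernoff transfer, lower edge for tight U-turns** (threshold `a·N`): `Σ_{S_N} t^{uturns} ≤ C Λ^N`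
at `0 < t < 1` and `0 < μlo ≤ μ` give `UTurnsLower a (Λ/(t^a μlo)) C`.
[cite: MadrasSlade1993, Theorem 7.2.3 (shape); PonitzTittmann2000, §3] -/
theorem chernoffLowerU (t Λ C a μlo : ℝ) (ht0 : 0 < t) (ht1 : t < 1) (hC : 0 ≤ C) (hμ0 : 0 < μlo)
    (hμ : μlo ≤ connectiveConstant 2) (hZ : ZUbendUpper t Λ C) :
    UTurnsLower a (Λ / (t ^ a * μlo)) C := by
  intro N
  have hta : 0 < t ^ a := Real.rpow_pos_of_pos ht0 a
  have hm : 0 < t ^ (a * (N : ℝ)) := Real.rpow_pos_of_pos ht0 _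
  have hΛ : 0 ≤ Λ := rate_nonneg_of_zubendUpper ht0 hC hZ
  have key := card_le_div_of_le_sum
    (filter_subset (fun ω => (uturns N ω : ℝ) ≤ a * (N : ℝ)) (Zd.saws 2 N))
    (f := fun ω => t ^ uturns N ω) (fun ω _ => pow_nonneg ht0.le _) hm
    (fun ω hω => by
      rw [mem_filter] at hω
      rw [← Real.rpow_natCast]
      exact Real.rpow_le_rpow_of_exponent_ge ht0 ht1.le hω.2) (hZ N)
  refine key.trans ?_
  rw [transfer_identity' ht0 hμ0]
  exact mono_mu hC (div_nonneg hΛ (mul_pos hta hμ0).le) hμ0 hμ N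

end Zd

end Literature.Probability.RandomPlanarGeometry.SAW

namespace Literature.Probability.RandomPlanarGeometry.SAW.Zd

/-! ### Monotonicity of the window shapes in `(θ, C)` (to merge two edges into one window) -/

/-- `TurnsLower` is monotone in `(θ, C)`. [cite: MadrasSlade1993, Theorem 7.2.3 (shape)] -/
theorem TurnsLower.mono {a θ C θ' C' : ℝ} (h : TurnsLower a θ C) (hθ0 : 0 ≤ θ) (hθ : θ ≤ θ')
    (hC0 : 0 ≤ C) (hC : C ≤ C') : TurnsLower a θ' C' := fun N =>
  (h N).trans (mul_le_mul (mul_le_mul hC (pow_le_pow_left₀ hθ0 hθ N) (pow_nonneg hθ0 N)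
    (hC0.trans hC)) le_rfl (pow_nonneg (connectiveConstant_pos 2).le N)
    (mul_nonneg (hC0.trans hC) (pow_nonneg (hθ0.trans hθ) N)))

/-- `TurnsUpper` is monotone in `(θ, C)`. [cite: MadrasSlade1993, Theorem 7.2.3 (shape)] -/
theorem TurnsUpper.mono {b θ C θ' C' : ℝ} (h : TurnsUpper b θ C) (hθ0 : 0 ≤ θ) (hθ : θ ≤ θ')
    (hC0 : 0 ≤ C) (hC : C ≤ C') : TurnsUpper b θ' C' := fun N =>
  (h N).trans (mul_le_mul (mul_le_mul hC (pow_le_pow_left₀ hθ0 hθ N) (pow_nonneg hθ0 N)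
    (hC0.trans hC)) le_rfl (pow_nonneg (connectiveConstant_pos 2).le N)
    (mul_nonneg (hC0.trans hC) (pow_nonneg (hθ0.trans hθ) N)))

/-- `UTurnsLower` is monotone in `(θ, C)`. [cite: MadrasSlade1993, Theorem 7.2.3 (shape)] -/
theorem UTurnsLower.mono {a θ C θ' C' : ℝ} (h : UTurnsLower a θ C) (hθ0 : 0 ≤ θ) (hθ : θ ≤ θ')
    (hC0 : 0 ≤ C) (hC : C ≤ C') : UTurnsLower a θ' C' := fun N =>
  (h N).trans (mul_le_mul (mul_le_mul hC (pow_le_pow_left₀ hθ0 hθ N) (pow_nonneg hθ0 N)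
    (hC0.trans hC)) le_rfl (pow_nonneg (connectiveConstant_pos 2).le N)
    (mul_nonneg (hC0.trans hC) (pow_nonneg (hθ0.trans hθ) N)))

/-- `UTurnsUpper` is monotone in `(θ, C)`. [cite: MadrasSlade1993, Theorem 7.2.3 (shape)] -/
theorem UTurnsUpper.mono {b θ C θ' C' : ℝ} (h : UTurnsUpper b θ C) (hθ0 : 0 ≤ θ) (hθ : θ ≤ θ')
    (hC0 : 0 ≤ C) (hC : C ≤ C') : UTurnsUpper b θ' C' := fun N =>
  (h N).trans (mul_le_mul (mul_le_mul hC (pow_le_pow_left₀ hθ0 hθ N) (pow_nonneg hθ0 N)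
    (hC0.trans hC)) le_rfl (pow_nonneg (connectiveConstant_pos 2).le N)
    (mul_nonneg (hC0.trans hC) (pow_nonneg (hθ0.trans hθ) N)))

/-- Two edges with `θ₁, θ₂ < 1` make a window. [cite: MadrasSlade1993, Theorem 7.2.3 (shape)] -/
theorem turnWindow_of_edges {a b θ₁ C₁ θ₂ C₂ : ℝ} (h₁ : TurnsLower a θ₁ C₁) (h₂ : TurnsUpper b θ₂ C₂)
    (hθ₁ : 0 ≤ θ₁) (hθ₁1 : θ₁ < 1) (hθ₂ : 0 ≤ θ₂) (hθ₂1 : θ₂ < 1) (hC₁ : 0 ≤ C₁) (hC₂ : 0 ≤ C₂) :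
    TurnWindow a b :=
  ⟨max θ₁ θ₂, max C₁ C₂, max_lt hθ₁1 hθ₂1,
    h₁.mono hθ₁ (le_max_left _ _) hC₁ (le_max_left _ _),
    h₂.mono hθ₂ (le_max_right _ _) hC₂ (le_max_right _ _)⟩

/-- Two U-turn edges with `θ₁, θ₂ < 1` make a window. [cite: MadrasSlade1993, Theorem 7.2.3 (shape)] -/
theorem uturnWindow_of_edges {a b θ₁ C₁ θ₂ C₂ : ℝ} (h₁ : UTurnsLower a θ₁ C₁) (h₂ : UTurnsUpper b θ₂ C₂)
    (hθ₁ : 0 ≤ θ₁) (hθ₁1 : θ₁ < 1) (hθ₂ : 0 ≤ θ₂) (hθ₂1 : θ₂ < 1) (hC₁ : 0 ≤ C₁) (hC₂ : 0 ≤ C₂) :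
    UTurnWindow a b :=
  ⟨max θ₁ θ₂, max C₁ C₂, max_lt hθ₁1 hθ₂1,
    h₁.mono hθ₁ (le_max_left _ _) hC₁ (le_max_left _ _),
    h₂.mono hθ₂ (le_max_right _ _) hC₂ (le_max_right _ _)⟩

/-- **The numeric test for an edge**: `Λ/(t^{m/n} μlo) < 1` follows from the rational inequality
`Λ^n < t^m μlo^n`. [cite: MadrasSlade1993, §1.2] -/
theorem theta_lt_one {Λ t μlo : ℝ} {m n : ℕ} (hn : n ≠ 0) (ht : 0 < t) (hμ : 0 < μlo)
    (h : Λ ^ n < t ^ m * μlo ^ n) : Λ / (t ^ ((m : ℝ) / n) * μlo) < 1 := by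
  have htx : 0 < t ^ ((m : ℝ) / n) := Real.rpow_pos_of_pos ht _
  rw [div_lt_one (mul_pos htx hμ)]
  by_contra hle
  rw [not_lt] at hle
  have h2 : (t ^ ((m : ℝ) / n) * μlo) ^ n ≤ Λ ^ n := pow_le_pow_left₀ (mul_pos htx hμ).le hle n
  have h3 : (t ^ ((m : ℝ) / n) * μlo) ^ n = t ^ m * μlo ^ n := by
    rw [mul_pow, ← Real.rpow_natCast (t ^ ((m : ℝ) / n)) n, ← Real.rpow_mul ht.le,
      div_mul_cancel₀ (m : ℝ) (Nat.cast_ne_zero.2 hn), Real.rpow_natCast]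
  linarith [h2, h3]

end Literature.Probability.RandomPlanarGeometry.SAW.Zd

end
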